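import Summits.ABC.IUTFork.Repair.Barrier
import Summits.ABC.IUTFork.Cor312PilotKummerNaturalWitness
import HarnessLib

/-!
# IUT REPAIR branch (A2.RP), BARRIER track, VIII: THE EDGE of the scale barrier — scale-RIGID containers; P♮ is one

Proof-only record (D-0012; no definition, no `Prop` fact) of the abc-iut cell, seat abc-iut-rp-bar, sequel to `Repair/Barrier` (p428000) /
`Repair/BarrierNaive` (p428451) / `Repair/Barrier4` (p429428). TAKES NO SIDE on [IUTchIII] Cor. 3.12 or between authors; typed ≠ proved.

WHY THIS FILE (honesty about the barrier's reach). BAR-Q(b) (`Repair.not_holds_of_qScaleInvariant`) kills a SCALE-BLIND sufficient candidate at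
a setting only if that setting admits ONE premise-preserving, `ρ`-compatible q-side rescaling that CHANGES the q-volume (hypothesis `hne`).
`Repair/Barrier4`'s «false at every model of record» (p429428) lists the models of record as of 06:45Z — all on the `p`-adic BALL frame,
where multiplication by the uniformizer rescales every hull-set (`NaiveFamily.rescale_logvol_ne`). Since then abc-iut-w5-d230's NATURAL
positive model P♮ (`NaturalWitness.natSetting`, p429252/p429573/p429651: the residual S holds through a GENUINE (Ind2)-move, the Corollary
holds STRICTLY) has become a profile point (REPAIR-SPEC §3 (e)). Its hull frame is the FIVE-element `natFrame = { {0}, halfPos, halfNeg,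
ball, univ }` with the four-level volume `natVol` — and this file proves it is **SCALE-RIGID**: every packet automorphism carrying the
q-pilot region `halfNeg` to a hull-set carries it to `halfPos` or `halfNeg`, of the SAME volume `−2` (`natSetting_qImage_volume_eq`);
hence the hypothesis `hne` of the scale barrier is UNSATISFIABLE at P♮ (`natSetting_no_volume_changing_qMove`): **BAR-Q(b) does not reach
P♮.** READING (neutral, for the table): scale-blind suppliers are excluded from every container whose hull-sets are stable under a non-unit
scalar (all `p`-adic ball frames — the arithmetic case), NOT from scale-rigid toy containers such as P♮'s; whether a scale-blind sufficient
candidate actually holds at P♮ is left open here (none of the branch's candidates is of that kind: each level-R supplier of record reads the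
q-datum's scale). The sentence «a scale-blind supplier has no T-c witness among the models of record» (Barrier4) is therefore to be read
with the list it states (M1, P♯, LS, P♭, Θ-singleton, the ball family) — P♮ is outside the barrier's mechanism, and that is the exact edge.
[claim: Mochizuki2012, status: disputed] [cite: ScholzeStix2018, §2.2 pp. 9–10]
-/

noncomputable section

open Set

namespace Summit.ABC.IUTFork.Repair

open Thm311 Cor312 Cor312Vol Literature.IUT.LogThetaLattice Cor312.Checks Cor312.IdentifiedNonVacuity
open Cor312Vol.NaturalWitness

namespace NaturalEdge

/-! ## 1. On P♮'s packets a hull-preserving image of the q-region has the q-region's volume -/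

/-- The two extreme points `±1` of the shell are never BOTH in the image of `halfNeg` under a packet automorphism (their preimages
would be two points of `[−1, 0]` with opposite line-coordinates, hence both `0`). [folklore] -/
theorem not_pm_one_mem_image_halfNeg (Λ : signShells.PacketAut) (j : toyIndex.Label) (vQ : toyIndex.VQ)
    (h1 : lpt j vQ 1 ∈ Λ j vQ '' halfNeg j vQ) (h2 : lpt j vQ (-1) ∈ Λ j vQ '' halfNeg j vQ) : False := by
  obtain ⟨x, hx, hx1⟩ := h1
  obtain ⟨y, hy, hy1⟩ := h2
  have hsum : Λ j vQ (x + y) = 0 := by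
    rw [map_add, hx1, hy1]
    apply eq_zero_of_line_eq_zero
    rw [map_add, line_lpt, line_lpt]; norm_num
  have hxy : x + y = 0 := (LinearEquiv.map_eq_zero_iff _).1 hsum
  have hline : line j vQ x + line j vQ y = 0 := by rw [← map_add, hxy, map_zero]
  have hx0 : line j vQ x = 0 := by
    have := hx.2; have := hy.2; have := hx.1; linarith
  have hx0' : x = 0 := eq_zero_of_line_eq_zero hx0
  have : lpt j vQ 1 = 0 := by rw [← hx1, hx0', map_zero]
  exact (lpt_one_mem j vQ).2.2.2 this

/-- **A hull-preserving image of the q-pilot region has the q-pilot region's volume** (P♮, every label): at a label of `𝔽_l^⋇` the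
image of `halfNeg` under a packet automorphism, if a hull-set, is `halfPos` or `halfNeg` (volume `−2` either way); at the zero label
both sides are `{0}`. [folklore] -/
theorem natSetting_qImage_volume_eq (Λ : signShells.PacketAut) (j : toyIndex.Label) (vQ : toyIndex.VQ)
    (hmem : Λ j vQ '' natSetting.qRegion j vQ ∈ natHul j vQ) :
    natVol j vQ (Λ j vQ '' natSetting.qRegion j vQ) = natVol j vQ (natSetting.qRegion j vQ) := by
  by_cases hj : j = 0
  · subst hj
    rw [natSetting_qRegion, (regionNat_zero 1 vQ).2, Set.image_singleton, map_zero]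
  · rw [natSetting_qRegion, qRegionNat_one_of_ne_zero hj] at hmem ⊢
    have hv := natVol_values j vQ
    rcases mem_natHul_iff.1 hmem with h | h | h | h | h
    · -- image = {0}: impossible, `Λ(lpt (−1)) ≠ 0`
      exfalso
      have hmemz : Λ j vQ (lpt j vQ (-1)) ∈ ({0} : Set (signShells.Packet j vQ)) :=
        h ▸ Set.mem_image_of_mem _ (lpt_neg_one_mem j vQ).1
      have h0 : lpt j vQ (-1) = 0 := (LinearEquiv.map_eq_zero_iff _).1 (Set.mem_singleton_iff.1 hmemz)
      have := congrArg (line j vQ) h0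
      rw [line_lpt, map_zero] at this
      norm_num at this
    · rw [h, hv.2.1, hv.2.2.1]
    · rw [h]
    · exfalso
      exact not_pm_one_mem_image_halfNeg Λ j vQ (h ▸ (lpt_one_mem j vQ).2.1) (h ▸ (lpt_neg_one_mem j vQ).2.1)
    · exfalso
      exact not_pm_one_mem_image_halfNeg Λ j vQ (h ▸ Set.mem_univ _) (h ▸ Set.mem_univ _)

/-! ## 2. P♮ is scale-rigid: the scale barrier's hypothesis `hne` is unsatisfiable there -/

/-- **P♮ IS SCALE-RIGID**: for EVERY packet-automorphism family `Λ` keeping the q-pilot image a hull-set (the `hmem` of a q-side move),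
the moved q-region has the ORIGINAL volume in every packet — so the hypothesis `hne` («some packet where the q-volume changes») of
`Repair.not_holds_of_qScaleInvariant` cannot be met at `natSetting`: BAR-Q(b) does not reach P♮. [folklore] -/
theorem natSetting_no_volume_changing_qMove (Λ : signShells.PacketAut)
    (hmem : ∀ (j : toyIndex.Label) (vQ : toyIndex.VQ),
      Λ j vQ '' natSetting.qRegionOf (qPilotObject natSetting.qData) j vQ ∈ (natSetting.frame j vQ).Hul) :
    ¬ ∃ (j : toyIndex.Label) (vQ : toyIndex.VQ),
      (natFull.D natSetting.n).logvol j vQ (Λ j vQ '' natSetting.qRegion j vQ) ≠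
        (natFull.D natSetting.n).logvol j vQ (natSetting.qRegion j vQ) := by
  rintro ⟨j, vQ, hne⟩
  exact hne (natSetting_qImage_volume_eq Λ j vQ (hmem j vQ))

/-- **THE EDGE, stated positively**: at P♮ every admissible q-side rescaling is volume-preserving on the q-region — in contrast with
EVERY member of the `p`-adic ball family, where the one-step rescaling by the uniformizer changes the q-volume
(`Repair.NaiveFamily.rescale_logvol_ne`). Scale-blind suppliers are excluded from the latter (Barrier4), not by this mechanism from the
former. [folklore] -/
theorem natSetting_scaleRigid (Λ : signShells.PacketAut)
    (hmem : ∀ (j : toyIndex.Label) (vQ : toyIndex.VQ),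
      Λ j vQ '' natSetting.qRegionOf (qPilotObject natSetting.qData) j vQ ∈ (natSetting.frame j vQ).Hul)
    (j : toyIndex.Label) (vQ : toyIndex.VQ) :
    (natFull.D natSetting.n).logvol j vQ (Λ j vQ '' natSetting.qRegion j vQ) =
      (natFull.D natSetting.n).logvol j vQ (natSetting.qRegion j vQ) :=
  natSetting_qImage_volume_eq Λ j vQ (hmem j vQ)

end NaturalEdge

end Summit.ABC.IUTFork.Repair

end
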